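import Literature.Computability.AlgebraicComplexity.ArithCircuitCodeBounds
import Literature.Computability.AlgebraicComplexity.ArithCircuitVars
import Literature.Computability.Complexity.RandomizedModularZeroTest
import HarnessLib

/-!
# `PITLanguage` as an instance of the randomised modular zero test (the slot semantics)

Topic `Computability/AlgebraicComplexity`. The tree's reusable randomised zero test
`Literature.Computability.Complexity.ModularZeroTest.mem_coRP_of_modularZeroTest`
(`Complexity/RandomizedModularZeroTest.lean`; Schwartz 1980, Ibarra–Moran 1983, Arora–Barak
Lemma 7.5 + §7.2.3) puts `{w | sem w = 0}` in `coRP` for any assignment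
`sem : w ↦ Q_w ∈ ℤ[X_0, …, X_{v(|w|)-1}]` with `deg Q_w ≤ 2^{d(|w|)}`, `Σ|coeff Q_w| ≤ 2^{2^{h(|w|)}}`
and a polynomial-time evaluator of `Q_w` at a point modulo a number. This file supplies the
assignment for the WHOLE language `PITLanguage` (`ValiantBooleanBridge.lean`: code words
`⟨bin n, encodeArithCircuit n C⟩` of integer circuits computing the zero polynomial;
Kabanets–Impagliazzo's ACIT), with `v = X + 1`, `d = X`, `h = 2X`:

* the number `n` of variables of an instance may be exponential in the length of its code, but a
  circuit READS at most `edgeSize + 1 ≤ |code|` of them; `ArithCircuit.slot C i` is the position of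
  the first occurrence of `x_i` among the operands of `C` (`List.idxOf`), injective on the
  variables read (`ArithCircuit.slot_injOn`), and `pitSem w` is `C.eval` with `x_i` RENAMED to
  `X_{slot i}` (clamped into `Fin (|w| + 1)`) when `w` is the code word `pitWord n C`, and the
  constant `1` otherwise;
* `pitSem_eq_zero_iff : pitSem w = 0 ↔ w ∈ PITLanguage` (a renaming injective on the variables
  of a polynomial kills it only if it is zero, `rename_eq_zero_iff_of_injOn_vars`);
* `totalDegree_pitSem_le`, `sum_abs_coeff_pitSem_le` — the hypotheses `hdeg`, `hL1` of the zero test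
  with `d = X`, `h = 2X` (from `ArithCircuitCodeBounds.lean`; the weight is invariant under a
  renaming injective on the variables, `weight_rename_of_injOn_vars`);
* `eval_pitSem_pitWord` — what an evaluator must compute on a code word: `C` at the point
  `x_i ↦ b_{slot C i}`;
* the closers `PITLanguage_mem_coRP_of_modularEvaluator`, `PITLanguage_mem_BPP_of_modularEvaluator`:
  `PITLanguage ∈ coRP` (resp. `BPP`) as soon as a one-bit `E ∈ FP` decides, on `⟨w, y⟩`, whether
  the modulus read off `y` is `≤ 1` or divides the value of `pitSem w` at the point read off `y`
  (the hypothesis `hspec` of the zero test, verbatim) — the machine, NOT built here: a total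
  decoder of `pitInstanceEncoding` answering `[r ≤ 1]` off the code words, and on `pitWord n C`
  the evaluation of `C` modulo `r` at `x_i ↦ (block (slot C i) of the point segment)`.

No machine and no named fact in this file. Honest framing: bookkeeping towards the textbook
membership `ACIT ∈ coRP`; nothing here bears on `VP` versus `VNP`.

## References

* [Schwartz1980] J. T. Schwartz, *Fast probabilistic algorithms for verification of polynomial
  identities*, J. ACM 27 (1980) 701–717, Cor. 1 and §3.
* [KabanetsImpagliazzo2004] V. Kabanets, R. Impagliazzo, *Derandomizing polynomial identity tests
  means proving circuit lower bounds*, Comput. Complexity 13 (2004) 1–46, §2 (ACIT, circuits as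
  strings; Lemma 2.2: ACIT ∈ coRP).
* [AroraBarakCC2009] S. Arora, B. Barak, *Computational Complexity: A Modern Approach*, CUP 2009,
  Lemma 7.5 and §7.2.3.
-/

noncomputable section

open MvPolynomial Computability
open Literature.Computability.Complexity

namespace Literature.Computability.AlgebraicComplexity

universe v

/-! ## Renamings injective on the variables of a polynomial -/

section RenameInjOn

variable {σ τ : Type*}

/-- A polynomial is a renaming of a polynomial in its own variables. [folklore] -/
private theorem exists_rename_subtype_vars_eq (P : MvPolynomial σ ℤ) :
    ∃ P₀ : MvPolynomial {i // i ∈ P.vars} ℤ, rename Subtype.val P₀ = P :=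
  exists_rename_eq_of_vars_subset_range P Subtype.val Subtype.val_injective (by simp)

/-- **A renaming injective on the variables of `P` sends `P` to `0` only if `P = 0`.**
[cite: AroraBarakCC2009, §7.2.3] -/
theorem rename_eq_zero_iff_of_injOn_vars {P : MvPolynomial σ ℤ} {f : σ → τ}
    (hf : Set.InjOn f ↑P.vars) : rename f P = 0 ↔ P = 0 := by
  refine ⟨fun h => ?_, fun h => by rw [h, map_zero]⟩
  obtain ⟨P₀, hP₀⟩ := exists_rename_subtype_vars_eq P
  have hinj : Function.Injective (f ∘ (Subtype.val : {i // i ∈ P.vars} → σ)) :=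
    fun a b hab => Subtype.ext (hf a.2 b.2 hab)
  rw [← hP₀, rename_rename] at h
  have h0 : P₀ = 0 := rename_injective _ hinj (by rw [h, map_zero])
  rw [← hP₀, h0, map_zero]

/-- **The weight is invariant under a renaming injective on the variables.** [cite: Burgisser2000TCS, §2 p. 76] -/
theorem weight_rename_of_injOn_vars {P : MvPolynomial σ ℤ} {f : σ → τ}
    (hf : Set.InjOn f ↑P.vars) : weight (rename f P) = weight P := by
  obtain ⟨P₀, hP₀⟩ := exists_rename_subtype_vars_eq P
  have hinj : Function.Injective (f ∘ (Subtype.val : {i // i ∈ P.vars} → σ)) :=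
    fun a b hab => Subtype.ext (hf a.2 b.2 hab)
  rw [← hP₀, rename_rename, weight_rename_of_injective hinj,
    weight_rename_of_injective Subtype.val_injective]

end RenameInjOn

/-! ## The slot of a variable: its first occurrence among the operands -/

namespace ArithCircuit

section Slot

variable {n : ℕ}

/-- Membership in `operandsVarSet`. [cite: Burgisser2000, Def. 2.1] -/
theorem mem_operandsVarSet_iff {us : List (Operand ℤ (Fin n))} {i : Fin n} :
    i ∈ operandsVarSet us ↔ Operand.var i ∈ us := by
  induction us with
  | nil => simp [operandsVarSet]
  | cons u us ih =>
    rw [operandsVarSet, List.foldr_cons, Finset.mem_union, ← operandsVarSet, ih, List.mem_cons]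
    cases u with
    | var j => simp [Operand.varSet]
    | const c => simp [Operand.varSet]
    | gate j => simp [Operand.varSet]

/-- Membership in `gatesVarSet`. [cite: Burgisser2000, Def. 2.1] -/
theorem mem_gatesVarSet_iff {gs : List (Gate ℤ (Fin n))} {i : Fin n} :
    i ∈ gatesVarSet gs ↔ ∃ g ∈ gs, Operand.var i ∈ g.args := by
  induction gs with
  | nil => simp [gatesVarSet]
  | cons g gs ih =>
    rw [gatesVarSet, List.foldr_cons, Finset.mem_union, ← gatesVarSet, ih, Gate.varSet,
      mem_operandsVarSet_iff]
    simp

/-- **A variable is read by a circuit iff it occurs among its operands.** [cite: Burgisser2000, Def. 2.1] -/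
theorem mem_varSet_iff_mem_operands (C : ArithCircuit ℤ (Fin n)) (i : Fin n) :
    i ∈ C.varSet ↔ Operand.var i ∈ C.operands := by
  rw [varSet, Finset.mem_union, mem_gatesVarSet_iff, operands, List.mem_append, List.mem_flatMap,
    List.mem_singleton]
  cases h : C.output with
  | var j => simp [Operand.varSet]
  | const c => simp [Operand.varSet]
  | gate j => simp [Operand.varSet]

/-- **The slot of the variable `x_i`**: the position of its first occurrence in the operand list of
`C` (`|operands|` if it does not occur). [cite: KabanetsImpagliazzo2004, §2] -/
def slot (C : ArithCircuit ℤ (Fin n)) (i : Fin n) : ℕ := C.operands.idxOf (Operand.var i)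

/-- A slot is at most the number of operand occurrences. [cite: KabanetsImpagliazzo2004, §2] -/
theorem slot_le_length_operands (C : ArithCircuit ℤ (Fin n)) (i : Fin n) : C.slot i ≤ C.operands.length :=
  List.idxOf_le_length

/-- **Slots are injective on the variables read.** [cite: KabanetsImpagliazzo2004, §2] -/
theorem slot_injOn (C : ArithCircuit ℤ (Fin n)) : Set.InjOn C.slot ↑C.varSet := by
  intro i hi j _ h
  have hi' : Operand.var i ∈ C.operands := (C.mem_varSet_iff_mem_operands i).1 hi
  have := (List.idxOf_inj hi').1 h
  simpa using this

/-- The number of operand occurrences is `edgeSize + 1`. [cite: Burgisser2000, Def. 2.1] -/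
theorem length_operands (C : ArithCircuit ℤ (Fin n)) : C.operands.length = C.edgeSize + 1 := by
  rw [operands, List.length_append, List.length_flatMap, List.length_singleton, edgeSize]
  rfl

/-- The operand list is shorter than the code. [cite: KabanetsImpagliazzo2004, §2] -/
theorem length_operands_le_length_encode (C : ArithCircuit ℤ (Fin n)) :
    C.operands.length ≤ (encodeArithCircuit n C).length := by
  rw [length_operands]
  have h1 := edgeSize_add_size_le_length_encode n C
  rcases Nat.eq_zero_or_pos C.size with h0 | hpos
  · -- no gates: no wires, and the code has at least two symbols
    have he : C.edgeSize = 0 := by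
      rw [edgeSize]
      have : C.gates = [] := List.eq_nil_of_length_eq_zero h0
      rw [this]; rfl
    have h2 : 2 ≤ (encodeArithCircuit n C).length := by
      change 2 ≤ (boolPair ((gateEncoding n).listBool.encode C.gates) ((operandEncoding n).encode C.output)).length
      rw [length_boolPair]; omega
    omega
  · omega

end Slot

end ArithCircuit

/-! ## The semantics `pitSem` -/

section Sem

open ArithCircuit

/-- The code word of the instance `⟨n, C⟩` of `PITLanguage`: `⟨bin n, encodeArithCircuit n C⟩`
(`= pitInstanceEncoding.encode ⟨n, C⟩`; twin of `KIReduction.circuitWord`, outside this file's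
import cone). [cite: KabanetsImpagliazzo2004, §2] -/
def pitWord (n : ℕ) (C : ArithCircuit ℤ (Fin n)) : List Bool := boolPair (encodeNat n) (encodeArithCircuit n C)

/-- `pitWord` is the instance encoding. [cite: KabanetsImpagliazzo2004, §2] -/
theorem pitWord_eq_encode (n : ℕ) (C : ArithCircuit ℤ (Fin n)) :
    pitWord n C = pitInstanceEncoding.encode ⟨n, C⟩ := rfl

/-- Membership of a code word in `PITLanguage`. [cite: KabanetsImpagliazzo2004, §2] -/
theorem pitWord_mem_PITLanguage_iff (n : ℕ) (C : ArithCircuit ℤ (Fin n)) :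
    pitWord n C ∈ PITLanguage ↔ C.eval = 0 :=
  mem_PITLanguage_iff n C

/-- Members of `PITLanguage` are code words. [cite: KabanetsImpagliazzo2004, §2] -/
theorem exists_pitWord_eq_of_mem_PITLanguage {w : List Bool} (hw : w ∈ PITLanguage) :
    ∃ p : (Σ n : ℕ, ArithCircuit ℤ (Fin n)), pitInstanceEncoding.encode p = w := by
  obtain ⟨n, C, hwC, -⟩ := hw
  exact ⟨⟨n, C⟩, hwC⟩

/-- The code of the circuit is shorter than the code word. [cite: KabanetsImpagliazzo2004, §2] -/
theorem length_encode_le_length_pitWord (n : ℕ) (C : ArithCircuit ℤ (Fin n)) :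
    (encodeArithCircuit n C).length ≤ (pitWord n C).length := by
  rw [pitWord, length_boolPair]; omega

/-- The number of variables of the semantics at input length `s`: `v = X + 1`, `v(s) = s + 1`.
[cite: Schwartz1980, §3] -/
def pitV : Polynomial ℕ := Polynomial.X + 1

/-- The degree exponent of the semantics: `d = X` (`deg ≤ 2^s`). [cite: Schwartz1980, §3] -/
def pitD : Polynomial ℕ := Polynomial.X

/-- The weight exponent of the semantics: `h = 2X` (`Σ|coeff| ≤ 2^(2^(2s))`). [cite: Schwartz1980, §3] -/
def pitH : Polynomial ℕ := 2 * Polynomial.X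

/-- `v(s) = s + 1`. [cite: Schwartz1980, §3] -/
@[simp] theorem eval_pitV (s : ℕ) : pitV.eval s = s + 1 := by simp [pitV]

/-- `d(s) = s`. [cite: Schwartz1980, §3] -/
@[simp] theorem eval_pitD (s : ℕ) : pitD.eval s = s := by simp [pitD]

/-- `h(s) = 2s`. [cite: Schwartz1980, §3] -/
@[simp] theorem eval_pitH (s : ℕ) : pitH.eval s = 2 * s := by simp [pitH]

/-- **The slot of `x_i`, clamped into `Fin (v(|w|))`, `v = X + 1`** (no clamping happens on a code
word: `slot C i ≤ |operands| ≤ |code| ≤ |w|`). [cite: KabanetsImpagliazzo2004, §2] -/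
def slotFin (w : List Bool) {n : ℕ} (C : ArithCircuit ℤ (Fin n)) (i : Fin n) :
    Fin (pitV.eval w.length) :=
  ⟨min (C.slot i) w.length, by rw [eval_pitV]; omega⟩

/-- On its own code word the clamped slot is the slot. [cite: KabanetsImpagliazzo2004, §2] -/
theorem val_slotFin_pitWord {n : ℕ} (C : ArithCircuit ℤ (Fin n)) (i : Fin n) :
    ((slotFin (pitWord n C) C i : ℕ)) = C.slot i := by
  change min (C.slot i) (pitWord n C).length = C.slot i
  exact min_eq_left ((C.slot_le_length_operands i).trans
    ((C.length_operands_le_length_encode).trans (length_encode_le_length_pitWord n C)))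

/-- The clamped slot is injective on the variables read (on the code word of the circuit). [cite: KabanetsImpagliazzo2004, §2] -/
theorem slotFin_injOn {n : ℕ} (C : ArithCircuit ℤ (Fin n)) :
    Set.InjOn (slotFin (pitWord n C) C) ↑C.varSet := by
  intro i hi j hj h
  have h' := congrArg Fin.val h
  rw [val_slotFin_pitWord, val_slotFin_pitWord] at h'
  exact C.slot_injOn hi hj h'

open Classical in
/-- **The semantics of a string for the modular zero test**, `v = X + 1` variables: on the code word
`pitWord n C` the polynomial `C.eval` with `x_i` renamed to `X_{slot C i}`; on every other string the
constant `1` (a nonzero polynomial: non-code-words are not in `PITLanguage`).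
[cite: KabanetsImpagliazzo2004, §2] [cite: Schwartz1980, §3] -/
def pitSem (w : List Bool) : MvPolynomial (Fin (pitV.eval w.length)) ℤ :=
  if h : ∃ p : (Σ n : ℕ, ArithCircuit ℤ (Fin n)), pitInstanceEncoding.encode p = w then
    rename (slotFin w h.choose.2) h.choose.2.eval
  else 1

/-- `pitSem` on a code word. [cite: KabanetsImpagliazzo2004, §2] -/
theorem pitSem_pitWord (n : ℕ) (C : ArithCircuit ℤ (Fin n)) :
    pitSem (pitWord n C) = rename (slotFin (pitWord n C) C) C.eval := by
  classical
  have hex : ∃ p : (Σ n : ℕ, ArithCircuit ℤ (Fin n)), pitInstanceEncoding.encode p = pitWord n C :=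
    ⟨⟨n, C⟩, rfl⟩
  rw [pitSem, dif_pos hex]
  have hp : hex.choose = ⟨n, C⟩ :=
    pitInstanceEncoding.encode_injective (hex.choose_spec.trans (pitWord_eq_encode n C))
  have key : ∀ p : (Σ n : ℕ, ArithCircuit ℤ (Fin n)), p = ⟨n, C⟩ →
      rename (slotFin (pitWord n C) p.2) p.2.eval = rename (slotFin (pitWord n C) C) C.eval := by
    rintro p rfl; rfl
  exact key _ hp

/-- `pitSem` off the code words is the constant `1`. [cite: KabanetsImpagliazzo2004, §2] -/
theorem pitSem_of_not_exists {w : List Bool}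
    (hw : ¬ ∃ p : (Σ n : ℕ, ArithCircuit ℤ (Fin n)), pitInstanceEncoding.encode p = w) : pitSem w = 1 := by
  classical
  rw [pitSem, dif_neg hw]

/-- **`pitSem w = 0 ↔ w ∈ PITLanguage`.** [cite: KabanetsImpagliazzo2004, §2] [cite: Schwartz1980, Cor. 1] -/
theorem pitSem_eq_zero_iff (w : List Bool) : pitSem w = 0 ↔ w ∈ PITLanguage := by
  by_cases hw : ∃ p : (Σ n : ℕ, ArithCircuit ℤ (Fin n)), pitInstanceEncoding.encode p = w
  · obtain ⟨⟨n, C⟩, rfl⟩ := hw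
    rw [← pitWord_eq_encode, pitSem_pitWord, pitWord_mem_PITLanguage_iff]
    exact rename_eq_zero_iff_of_injOn_vars ((slotFin_injOn C).mono (by exact_mod_cast C.vars_eval_subset))
  · rw [pitSem_of_not_exists hw]
    simp only [one_ne_zero, false_iff]
    exact fun h => hw (exists_pitWord_eq_of_mem_PITLanguage h)

/-- `{w | pitSem w = 0} = PITLanguage`. [cite: KabanetsImpagliazzo2004, §2] -/
theorem setOf_pitSem_eq_zero : ({w | pitSem w = 0} : Language Bool) = PITLanguage :=
  Language.ext fun w => pitSem_eq_zero_iff w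

/-- **Degree**: `deg (pitSem w) ≤ 2^{d(|w|)}`, `d = X`. [cite: Schwartz1980, §3] -/
theorem totalDegree_pitSem_le (w : List Bool) :
    (pitSem w).totalDegree ≤ 2 ^ pitD.eval w.length := by
  rw [eval_pitD]
  by_cases hw : ∃ p : (Σ n : ℕ, ArithCircuit ℤ (Fin n)), pitInstanceEncoding.encode p = w
  · obtain ⟨⟨n, C⟩, rfl⟩ := hw
    rw [← pitWord_eq_encode, pitSem_pitWord]
    exact (totalDegree_rename_le _ _).trans ((totalDegree_eval_le_two_pow_length_encode n C).trans
      (Nat.pow_le_pow_right (by norm_num) (length_encode_le_length_pitWord n C)))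
  · rw [pitSem_of_not_exists hw, totalDegree_one]
    exact Nat.zero_le _

/-- **Weight**: `Σ |coeff (pitSem w)| ≤ 2^{2^{h(|w|)}}`, `h = 2X`. [cite: Schwartz1980, §3] -/
theorem sum_abs_coeff_pitSem_le (w : List Bool) :
    ∑ m ∈ (pitSem w).support, |(pitSem w).coeff m| ≤ (2 : ℤ) ^ 2 ^ pitH.eval w.length := by
  rw [← ArithCircuit.natCast_weight, eval_pitH]
  have key : weight (pitSem w) ≤ 2 ^ 2 ^ (2 * w.length) := by
    by_cases hw : ∃ p : (Σ n : ℕ, ArithCircuit ℤ (Fin n)), pitInstanceEncoding.encode p = w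
    · obtain ⟨⟨n, C⟩, rfl⟩ := hw
      rw [← pitWord_eq_encode, pitSem_pitWord,
        weight_rename_of_injOn_vars ((slotFin_injOn C).mono (by exact_mod_cast C.vars_eval_subset))]
      have hst : (encodeArithCircuit n C).length ≤ (pitWord n C).length := length_encode_le_length_pitWord n C
      have h' : (pitWord n C).length * 2 ^ (pitWord n C).length ≤ 2 ^ (2 * (pitWord n C).length) := by
        rw [two_mul, pow_add]
        exact Nat.mul_le_mul_right _ (Nat.lt_two_pow_self).le
      calc weight C.eval
          ≤ 2 ^ ((encodeArithCircuit n C).length * 2 ^ (encodeArithCircuit n C).length) :=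
            weight_eval_le_two_pow_length_encode n C
        _ ≤ 2 ^ ((pitWord n C).length * 2 ^ (pitWord n C).length) :=
            Nat.pow_le_pow_right Nat.two_pos (Nat.mul_le_mul hst (Nat.pow_le_pow_right Nat.two_pos hst))
        _ ≤ 2 ^ 2 ^ (2 * (pitWord n C).length) := Nat.pow_le_pow_right Nat.two_pos h'
    · rw [pitSem_of_not_exists hw, weight_one]
      exact Nat.one_le_two_pow
  exact_mod_cast key

/-- **What the evaluator computes on a code word**: the value of `pitSem (pitWord n C)` at `b` is the
value of `C` at the point `x_i ↦ b_{slot C i}`. [cite: Schwartz1980, §3] -/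
theorem eval_pitSem_pitWord {n : ℕ} (C : ArithCircuit ℤ (Fin n))
    (b : Fin (pitV.eval (pitWord n C).length) → ℤ) :
    MvPolynomial.eval b (pitSem (pitWord n C)) =
      MvPolynomial.eval (fun i : Fin n => b (slotFin (pitWord n C) C i)) C.eval := by
  rw [pitSem_pitWord, MvPolynomial.eval_rename]
  rfl

/-- Off the code words the evaluator's verdict is `[r ≤ 1]` (`r ∣ 1 ↔ r = 1` for the modulus
`r : ℕ`). [cite: AroraBarakCC2009, §7.2.3] -/
theorem modulus_dvd_eval_pitSem_of_not_exists {w : List Bool}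
    (hw : ¬ ∃ p : (Σ n : ℕ, ArithCircuit ℤ (Fin n)), pitInstanceEncoding.encode p = w)
    (r : ℕ) (b : Fin (pitV.eval w.length) → ℤ) :
    (r ≤ 1 ∨ (r : ℤ) ∣ MvPolynomial.eval b (pitSem w)) ↔ r ≤ 1 := by
  rw [pitSem_of_not_exists hw, map_one]
  constructor
  · rintro (h | h)
    · exact h
    · have := Int.eq_one_of_dvd_one (Int.natCast_nonneg r) h
      omega
  · exact Or.inl

end Sem

/-! ## The closers: `PITLanguage ∈ coRP` from a modular evaluator -/

section Closer

open ModularZeroTest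

/-- **`PITLanguage ∈ coRP` from a polynomial-time modular evaluator** (Schwartz 1980; Ibarra–Moran
1983; Kabanets–Impagliazzo 2004, Lemma 2.2 "ACIT ∈ coRP"): the tree's
`mem_coRP_of_modularZeroTest` instantiated at `sem := pitSem`, `v = pitV = X + 1`, `d = pitD = X`,
`h = pitH = 2X`. The remaining hypothesis is its `hspec` verbatim: a one-bit `E ∈ FP` answering, on
`⟨w, y⟩` with `|y| = coinPoly pitV pitD pitH |w|`, whether the modulus `modOf (KOf pitD pitH |w|) y` is
`≤ 1` or divides the value of `pitSem w` at the point
`ptOf (kOf pitD pitH |w|) (|w|+1) (pointSeg pitD pitH |w| y)` — by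
`eval_pitSem_pitWord` / `modulus_dvd_eval_pitSem_of_not_exists`: off the code words the bit
`[r ≤ 1]`, on `pitWord n C` the bit `[r ≤ 1 ∨ r ∣ C(x_i ↦ block (slot C i) of the point segment)]`.
[cite: KabanetsImpagliazzo2004, Lemma 2.2] [cite: Schwartz1980, Cor. 1 and §3] -/
theorem PITLanguage_mem_coRP_of_modularEvaluator {E : List Bool → List Bool} (hE : E ∈ FP)
    (hbit : ∀ z, E z = [true] ∨ E z = [false])
    (hspec : ∀ w y : List Bool, y.length = (coinPoly pitV pitD pitH).eval w.length →
      (E (boolPair w y) = [true] ↔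
        (modOf (KOf pitD pitH w.length) y ≤ 1 ∨
          ((modOf (KOf pitD pitH w.length) y : ℤ) ∣
            MvPolynomial.eval (ptOf (kOf pitD pitH w.length) (pitV.eval w.length)
              (pointSeg pitD pitH w.length y)) (pitSem w))))) :
    PITLanguage ∈ coRP := by
  rw [← setOf_pitSem_eq_zero]
  exact mem_coRP_of_modularZeroTest pitSem totalDegree_pitSem_le sum_abs_coeff_pitSem_le hE hbit hspec

/-- **… and `PITLanguage ∈ BPP`** under the same evaluator. [cite: KabanetsImpagliazzo2004, Lemma 2.2] -/
theorem PITLanguage_mem_BPP_of_modularEvaluator {E : List Bool → List Bool} (hE : E ∈ FP)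
    (hbit : ∀ z, E z = [true] ∨ E z = [false])
    (hspec : ∀ w y : List Bool, y.length = (coinPoly pitV pitD pitH).eval w.length →
      (E (boolPair w y) = [true] ↔
        (modOf (KOf pitD pitH w.length) y ≤ 1 ∨
          ((modOf (KOf pitD pitH w.length) y : ℤ) ∣
            MvPolynomial.eval (ptOf (kOf pitD pitH w.length) (pitV.eval w.length)
              (pointSeg pitD pitH w.length y)) (pitSem w))))) :
    PITLanguage ∈ BPP := by
  rw [← setOf_pitSem_eq_zero]
  exact mem_BPP_of_modularZeroTest pitSem totalDegree_pitSem_le sum_abs_coeff_pitSem_le hE hbit hspec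

end Closer

end Literature.Computability.AlgebraicComplexity
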